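import Mathlib
import HarnessLib
import Literature.MathematicalPhysics.StatisticalMechanics.StrongNormExpSecondDiff
import Literature.MathematicalPhysics.StatisticalMechanics.InitialActivityHamiltonianNorm
import Literature.MathematicalPhysics.StatisticalMechanics.PolymerProductSecondDifference

/-!
# Second differences of the polymer Boltzmann factor `e^{−H(X)} = ∏_{B ∈ 𝓑_k(X)} e^{−H(B)}` in `H`
# ([ABKM19] Lemma 9.3 `D²E`, difference form, polymer level, torus data)

Continuation of `StrongNormExpSecondDiff.lean` (one block) and `PolymerProductSecondDifference.lean`
(products).  On a `k`-polymer `X` the Boltzmann factor of a relevant Hamiltonian factorises over the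
`k`-blocks (`bprod_cexp_neg_eval`), and its weight is the product of the strong block weights
(`prod_expWeight_blocks`).  Over a parallelogram `H, H+Y, H+Z, H+Y+Z` the per-block factors
`a^{ij}_B = e^{−(H+iY+jZ)(B)}` do NOT form parallelograms (`γ_B = Σ± a^{ij}_B ≠ 0`), so the mixed second
difference of the product is split as
`∏a^{11} − ∏a^{10} − ∏a^{01} + ∏a^{00} = [∏(K+U+W) − ∏(K+U) − ∏(K+W) + ∏K] + [∏(a^{01} + γ) − ∏a^{01}]`
with `K = a^{00}`, `U = a^{10} − a^{00}`, `W = a^{11} − a^{10}`, `K + W = a^{01} + γ`: the first bracket is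
`tayNormLE_prod_secondDiff` (sizes `e^{1/4}`, `16e^{3/8}‖Y‖`, `16e^{3/8}‖Z‖` from Lemma 9.3 and its
Lipschitz form), the second is `tayNormLE_prod_sub_prod` with the per-block second differences
`γ_B` of size `256e^{1/4}‖Y‖‖Z‖` (`tayNormLE_expNegH_secondDiff_strong_abkm`).

* **`tayNormLE_expNegH_secondDiff_polymer_abkm`** — the resulting bound in the gauge `T_k^{X*}` and
  strong weight `W_k^X` of the torus data (`abkmNormParams`/`abkmWeightData`), with the explicit
  constant `Δ²_{α,β}[(·)^m](a) + ((a+γ)^m − a^m)`, `m = |X|_k`, `a = e^{1/4}`, `α = 16e^{3/8}‖Y‖_{k,0}`,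
  `β = 16e^{3/8}‖Z‖_{k,0}`, `γ = 256e^{1/4}‖Y‖_{k,0}‖Z‖_{k,0}` — bilinear in `(‖Y‖, ‖Z‖)` for bounded `m`.

This is the `ℋℋ`-slot of the joint second differences of `K̂_0(𝒦, ℋ) = e^{−ℋ}∏𝒦` (hypothesis `hμ12`
of `RGFlow.secondDiff_initial_le_of_isTunedQ`) and of the `H`-slots of the renormalisation maps.
Everything is proved; no named fact.

## References
* S. Adams, S. Buchholz, R. Kotecký, S. Müller, arXiv:1910.13564, Lemma 9.3 (9.13)–(9.16), Lemma 9.4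
  (9.20), Lemma 12.2 [AdamsBuchholzKoteckyMuller2019].
-/

noncomputable section

namespace Literature.MathematicalPhysics.StatisticalMechanics.GradientRG

open scoped BigOperators Classical
open Finset Matrix
open Literature.MathematicalPhysics.StatisticalMechanics.TorusPolymer
  (IsPolymer blocks bprod blockOf thicken numBlocks mem_blocks subset_thicken thicken_mono
    isPolymer_empty card_blocks_eq_numBlocks)
open Literature.MathematicalPhysics.QuantumFieldTheory

variable {d M : ℕ} [NeZero M]

/-- **Second differences of `e^{−H(X)}` in `H` on a `k`-polymer, torus data** ([ABKM19] Lemma 9.3,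
`D²E`, polymer level, difference form).  For the torus data (`AbkmWeightBounds`, `h² ≥ h₀²`), `k ≤ N`,
a `k`-polymer `X`, and relevant Hamiltonians with `‖H‖, ‖H+Y‖, ‖H+Z‖, ‖H+Y+Z‖ ≤ 1/16` and
`‖Y‖, ‖Z‖ ≤ 1/32` (coefficient norms at `(𝔥_k, L^k, L^{dk})`):
`|e^{−(H+Y+Z)(X)} − e^{−(H+Y)(X)} − e^{−(H+Z)(X)} + e^{−H(X)}|_{T_k^{X*}, W_k^X}
 ≤ [(a+α+β)^m − (a+α)^m − (a+β)^m + a^m] + [(a+γ)^m − a^m]`, `m = |X|_k`.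
[cite: AdamsBuchholzKoteckyMuller2019, Lemma 9.3 (9.13)] -/
theorem tayNormLE_expNegH_secondDiff_polymer_abkm {L N Mord R n p r₀ k : ℕ} {θbar lam μ δ₁ δ₀ A𝒫 h A : ℝ}
    {𝒞 : ℕ → (Fin d → ZMod M) → ℝ} (hd : 2 ≤ d) (hLodd : Odd L) (hM : M = L ^ N) (hk : k ≤ N)
    (hp : d / 2 + 1 ≤ p) (hMord : d / 2 + 1 ≤ Mord)
    (hB : AbkmWeightBounds L N Mord R n θbar lam μ δ₁ δ₀ A𝒫 𝒞
      (abkmWeightData L N Mord R θbar (schedDelta δ₀ δ₁ N) 𝒞))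
    (hδ₀ : 0 < δ₀) (hδ₁ : 0 < δ₁) (hh : 0 < h) (hh0 : hZeroSq d R δ₀ δ₁ ≤ h ^ 2)
    {H Y Z : RelevantHamiltonian ℂ d}
    (hH : hamNorm (fieldWt h (L : ℝ) d k) ((L : ℝ) ^ k) (L ^ (d * k)) H ≤ 1 / 16)
    (hHY : hamNorm (fieldWt h (L : ℝ) d k) ((L : ℝ) ^ k) (L ^ (d * k)) (H + Y) ≤ 1 / 16)
    (hHZ : hamNorm (fieldWt h (L : ℝ) d k) ((L : ℝ) ^ k) (L ^ (d * k)) (H + Z) ≤ 1 / 16)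
    (hHYZ : hamNorm (fieldWt h (L : ℝ) d k) ((L : ℝ) ^ k) (L ^ (d * k)) (H + Y + Z) ≤ 1 / 16)
    (hY : hamNorm (fieldWt h (L : ℝ) d k) ((L : ℝ) ^ k) (L ^ (d * k)) Y ≤ 1 / 32)
    (hZ : hamNorm (fieldWt h (L : ℝ) d k) ((L : ℝ) ^ k) (L ^ (d * k)) Z ≤ 1 / 32)
    {X : Finset (Fin d → ZMod M)} (hX : IsPolymer (L ^ k) X) :
    TayNormLE ((abkmNormParams L N Mord R p r₀ h θbar A (schedDelta δ₀ δ₁ N) 𝒞).gauge k X) r₀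
      (expWeight (strongCoef h N k • derivForm (L : ℝ) k (diffIndex d Mord)
        (boxDensity (boxRad R L k) (boxWt (L : ℝ) d k) X)))
      (fun φ => expNegH (H + Y + Z) X φ - expNegH (H + Y) X φ - expNegH (H + Z) X φ + expNegH H X φ)
      ((((Real.exp (1 / 4) + 16 * Real.exp (3 / 8) * hamNorm (fieldWt h (L : ℝ) d k) ((L : ℝ) ^ k) (L ^ (d * k)) Y
            + 16 * Real.exp (3 / 8) * hamNorm (fieldWt h (L : ℝ) d k) ((L : ℝ) ^ k) (L ^ (d * k)) Z) ^ numBlocks (L ^ k) X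
          - (Real.exp (1 / 4) + 16 * Real.exp (3 / 8) * hamNorm (fieldWt h (L : ℝ) d k) ((L : ℝ) ^ k) (L ^ (d * k)) Y)
              ^ numBlocks (L ^ k) X)
        - ((Real.exp (1 / 4) + 16 * Real.exp (3 / 8) * hamNorm (fieldWt h (L : ℝ) d k) ((L : ℝ) ^ k) (L ^ (d * k)) Z)
              ^ numBlocks (L ^ k) X - Real.exp (1 / 4) ^ numBlocks (L ^ k) X))
        + ((Real.exp (1 / 4) + 256 * Real.exp (1 / 4) * hamNorm (fieldWt h (L : ℝ) d k) ((L : ℝ) ^ k) (L ^ (d * k)) Y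
              * hamNorm (fieldWt h (L : ℝ) d k) ((L : ℝ) ^ k) (L ^ (d * k)) Z) ^ numBlocks (L ^ k) X
          - Real.exp (1 / 4) ^ numBlocks (L ^ k) X)) := by
  set P := abkmNormParams L N Mord R p r₀ h θbar A (schedDelta δ₀ δ₁ N) 𝒞 with hP
  set W := abkmWeightData L N Mord R θbar (schedDelta δ₀ δ₁ N) 𝒞 with hW
  set s := L ^ k with hs
  set nY := hamNorm (fieldWt h (L : ℝ) d k) ((L : ℝ) ^ k) (L ^ (d * k)) Y with hnY
  set nZ := hamNorm (fieldWt h (L : ℝ) d k) ((L : ℝ) ^ k) (L ^ (d * k)) Z with hnZ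
  set a := Real.exp (1 / 4) with hadef
  set α := 16 * Real.exp (3 / 8) * nY with hαdef
  set β := 16 * Real.exp (3 / 8) * nZ with hβdef
  set γ := 256 * Real.exp (1 / 4) * nY * nZ with hγdef
  have hL0 : (0 : ℝ) < L := by exact_mod_cast hLodd.pos
  obtain ⟨t, ht⟩ : ∃ t, N = k + t := ⟨N - k, by omega⟩
  have hMt : M = s * L ^ t := by rw [hs, ← pow_add, ← ht]; exact hM
  have htodd : Odd (L ^ t) := hLodd.pow
  have hsodd : Odd s := hLodd.pow
  have h𝔥 : 0 < fieldWt h (L : ℝ) d k := fieldWt_pos hh hL0 d k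
  have hR0 : (0 : ℝ) < (L : ℝ) ^ k := by positivity
  have hnY0 : 0 ≤ nY := hamNorm_nonneg h𝔥.le hR0.le _ _
  have hnZ0 : 0 ≤ nZ := hamNorm_nonneg h𝔥.le hR0.le _ _
  have ha0 : 0 ≤ a := (Real.exp_pos _).le
  have hα0 : 0 ≤ α := by positivity
  have hβ0 : 0 ≤ β := by positivity
  have hγ0 : 0 ≤ γ := by positivity
  -- strong family
  set G : ℕ → Finset (Fin d → ZMod M) → Matrix (Fin d → ZMod M) (Fin d → ZMod M) ℝ :=
    fun j Y' => strongCoef h N j • derivForm (L : ℝ) j (diffIndex d Mord)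
      (boxDensity (boxRad R L j) (boxWt (L : ℝ) d j) Y') with hG
  have hGs : W.StrongDominated G fun _ X Y => Disjoint X Y :=
    hB.strong (diffIndex d Mord) (fun α hα => hα) (strongCoef h N) (strongCoef_le hδ₀ hδ₁ hh hh0)
  have hX' : IsPolymer s X := hX
  have hcard : ∀ x : Fin d → ZMod M, (blockOf s x).card = L ^ (d * k) := fun x => by
    rw [TorusPolymer.card_blockOf hMt hsodd htodd x, hs, ← pow_mul, mul_comm]
  have hgauge : ∀ Y' ⊆ X, ∀ ξ, ‖P.gauge k Y' ξ‖ ≤ ‖P.gauge k X ξ‖ := fun Y' hY' ξ =>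
    norm_fieldGauge_mono_set _ _ _ (thicken_mono _ hY') ξ
  have hleb : ∀ B ∈ blocks s X, ∀ ξ, ‖P.gauge k B ξ‖ ≤ ‖P.gauge k X ξ‖ := fun B hBm =>
    hgauge B (hX'.subset_of_mem_blocks hBm)
  -- per-block estimates (Lemma 9.3: value, Lipschitz, second difference)
  have hval : ∀ (H₀ : RelevantHamiltonian ℂ d), hamNorm (fieldWt h (L : ℝ) d k) ((L : ℝ) ^ k) (L ^ (d * k)) H₀ ≤ 1 / 8 →
      ∀ B ∈ blocks s X, TayNormLE (P.gauge k B) r₀ (expWeight (G k B)) (expNegH H₀ B) a := by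
    intro H₀ hH₀ B hBm
    obtain ⟨x, -, rfl⟩ := mem_blocks.1 hBm
    have hH₀' : hamNorm (fieldWt h (L : ℝ) d k) ((L : ℝ) ^ k) (blockOf s x).card H₀ ≤ 1 / 8 := by
      rw [hcard x]; exact hH₀
    exact tayNormLE_expNegH_strong_abkm (R := R) (N := N) (Mord := Mord) hd hLodd hM hk hh hMord hp
      (subset_thicken (P.rad k) (blockOf s x)) r₀ hH₀'
  have hlip : ∀ (H₁ H₂ : RelevantHamiltonian ℂ d),
      hamNorm (fieldWt h (L : ℝ) d k) ((L : ℝ) ^ k) (L ^ (d * k)) H₁ ≤ 1 / 16 →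
      hamNorm (fieldWt h (L : ℝ) d k) ((L : ℝ) ^ k) (L ^ (d * k)) H₂ ≤ 1 / 16 →
      ∀ B ∈ blocks s X, TayNormLE (P.gauge k B) r₀ (expWeight (G k B))
        (fun φ => expNegH H₁ B φ - expNegH H₂ B φ)
        (16 * Real.exp (3 / 8) * hamNorm (fieldWt h (L : ℝ) d k) ((L : ℝ) ^ k) (L ^ (d * k)) (H₁ - H₂)) := by
    intro H₁ H₂ hH₁ hH₂ B hBm
    obtain ⟨x, -, rfl⟩ := mem_blocks.1 hBm
    have h1 : hamNorm (fieldWt h (L : ℝ) d k) ((L : ℝ) ^ k) (blockOf s x).card H₁ ≤ 1 / 16 := by rw [hcard x]; exact hH₁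
    have h2 : hamNorm (fieldWt h (L : ℝ) d k) ((L : ℝ) ^ k) (blockOf s x).card H₂ ≤ 1 / 16 := by rw [hcard x]; exact hH₂
    have h := tayNormLE_expNegH_sub_strong_abkm (R := R) (N := N) (Mord := Mord) hd hLodd hM hk hh hMord hp
      (subset_thicken (P.rad k) (blockOf s x)) r₀ h1 h2
    rw [hcard x] at h
    exact h
  have hsec : ∀ B ∈ blocks s X, TayNormLE (P.gauge k B) r₀ (expWeight (G k B))
      (fun φ => expNegH (H + Y + Z) B φ - expNegH (H + Y) B φ - expNegH (H + Z) B φ + expNegH H B φ) γ := by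
    intro B hBm
    obtain ⟨x, -, rfl⟩ := mem_blocks.1 hBm
    have h1 : hamNorm (fieldWt h (L : ℝ) d k) ((L : ℝ) ^ k) (blockOf s x).card H ≤ 1 / 16 := by rw [hcard x]; exact hH
    have h2 : hamNorm (fieldWt h (L : ℝ) d k) ((L : ℝ) ^ k) (blockOf s x).card Y ≤ 1 / 32 := by rw [hcard x]; exact hY
    have h3 : hamNorm (fieldWt h (L : ℝ) d k) ((L : ℝ) ^ k) (blockOf s x).card Z ≤ 1 / 32 := by rw [hcard x]; exact hZ
    have h := tayNormLE_expNegH_secondDiff_strong_abkm (R := R) (N := N) (Mord := Mord) hd hLodd hM hk hh hMord hp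
      (subset_thicken (P.rad k) (blockOf s x)) r₀ h1 h2 h3
    rw [hcard x] at h
    exact h
  -- regularity and locality of the block functionals
  have hEd : ∀ (H₀ : RelevantHamiltonian ℂ d) (B : Finset (Fin d → ZMod M)), ContDiff ℝ r₀ (expNegH H₀ B) :=
    fun H₀ B => (contDiff_eval H₀ B (n := r₀)).neg.cexp
  have hEloc : ∀ (H₀ : RelevantHamiltonian ℂ d), ∀ B ∈ blocks s X, IsGaugeLocal (P.gauge k B) (expNegH H₀ B) :=
    fun H₀ B _ => isGaugeLocal_cexp_neg_eval h𝔥.ne' hR0.ne' hp (subset_thicken _ _) H₀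
  -- the sizes of the increments
  have eY : H + Y - H = Y := by abel
  have eZ' : H + Y + Z - (H + Y) = Z := by abel
  have hU : ∀ B ∈ blocks s X, TayNormLE (P.gauge k B) r₀ (expWeight (G k B))
      (fun φ => expNegH (H + Y) B φ - expNegH H B φ) α := by
    intro B hBm
    have h := hlip (H + Y) H hHY hH B hBm
    rw [eY] at h
    exact h
  have hWW : ∀ B ∈ blocks s X, TayNormLE (P.gauge k B) r₀ (expWeight (G k B))
      (fun φ => expNegH (H + Y + Z) B φ - expNegH (H + Y) B φ) β := by
    intro B hBm
    have h := hlip (H + Y + Z) (H + Y) hHYZ hHY B hBm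
    rw [eZ'] at h
    exact h
  -- first bracket: `tayNormLE_prod_secondDiff` with `K = a⁰⁰`, `U = a¹⁰ − a⁰⁰`, `W = a¹¹ − a¹⁰`
  have h1 := tayNormLE_prod_secondDiff (T := P.gauge k X) (Ti := fun B => P.gauge k B)
    (wi := fun B => expWeight (G k B)) (Ki := fun B => expNegH H B)
    (Ui := fun B => fun φ => expNegH (H + Y) B φ - expNegH H B φ)
    (Wi := fun B => fun φ => expNegH (H + Y + Z) B φ - expNegH (H + Y) B φ)
    (c := fun _ => a) (u := fun _ => α) (v := fun _ => β)
    (w := fun φ => ∏ B ∈ blocks s X, expWeight (G k B) φ) (blocks s X)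
    (hval H (hH.trans (by norm_num))) hU hWW hleb
    (fun B _ => hEd H B) (fun B _ => (hEd (H + Y) B).sub (hEd H B)) (fun B _ => (hEd (H + Y + Z) B).sub (hEd (H + Y) B))
    (hEloc H) (fun B hBm => IsGaugeLocal.op₂ _ (fun u v : ℂ => u - v) (hEloc (H + Y) B hBm) (hEloc H B hBm))
    (fun B hBm => IsGaugeLocal.op₂ _ (fun u v : ℂ => u - v) (hEloc (H + Y + Z) B hBm) (hEloc (H + Y) B hBm))
    (fun _ _ => ha0) (fun _ _ => hα0) (fun _ _ => hβ0) (fun φ => le_rfl)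
  -- second bracket: `tayNormLE_prod_sub_prod` with base `a⁰¹` and increments `γ_B`
  have hΔ2 : ∀ B ∈ blocks s X, TayNormLE (P.gauge k B) r₀ (expWeight (G k B))
      (fun φ => (expNegH H B φ + (expNegH (H + Y + Z) B φ - expNegH (H + Y) B φ)) - expNegH (H + Z) B φ) γ := by
    intro B hBm
    have e : (fun φ => (expNegH H B φ + (expNegH (H + Y + Z) B φ - expNegH (H + Y) B φ)) - expNegH (H + Z) B φ)
        = fun φ => expNegH (H + Y + Z) B φ - expNegH (H + Y) B φ - expNegH (H + Z) B φ + expNegH H B φ := by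
      funext φ; ring
    rw [e]; exact hsec B hBm
  have h2 := tayNormLE_prod_sub_prod (T := P.gauge k X) (Ti := fun B => P.gauge k B)
    (wi := fun B => expWeight (G k B))
    (Ki := fun B => fun φ => expNegH H B φ + (expNegH (H + Y + Z) B φ - expNegH (H + Y) B φ))
    (Ki' := fun B => expNegH (H + Z) B) (c := fun _ => a) (ρ := fun _ => γ)
    (w := fun φ => ∏ B ∈ blocks s X, expWeight (G k B) φ) (blocks s X)
    (hval (H + Z) (hHZ.trans (by norm_num))) hΔ2 hleb
    (fun B _ => (hEd H B).add ((hEd (H + Y + Z) B).sub (hEd (H + Y) B))) (fun B _ => hEd (H + Z) B)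
    (fun B hBm => IsGaugeLocal.op₂ _ (fun u v : ℂ => u + v) (hEloc H B hBm)
      (IsGaugeLocal.op₂ _ (fun u v : ℂ => u - v) (hEloc (H + Y + Z) B hBm) (hEloc (H + Y) B hBm)))
    (hEloc (H + Z)) (fun _ _ => ha0) (fun _ _ => hγ0) (fun φ => le_rfl)
  -- add and identify
  have hA : ContDiff ℝ r₀ (fun φ => ∏ B ∈ blocks s X, (expNegH H B φ + (expNegH (H + Y) B φ - expNegH H B φ)
      + (expNegH (H + Y + Z) B φ - expNegH (H + Y) B φ))) :=
    contDiff_prod fun B _ => ((hEd H B).add ((hEd (H + Y) B).sub (hEd H B))).add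
      ((hEd (H + Y + Z) B).sub (hEd (H + Y) B))
  have hBB : ContDiff ℝ r₀ (fun φ => ∏ B ∈ blocks s X, (expNegH H B φ + (expNegH (H + Y) B φ - expNegH H B φ))) :=
    contDiff_prod fun B _ => (hEd H B).add ((hEd (H + Y) B).sub (hEd H B))
  have hC : ContDiff ℝ r₀ (fun φ => ∏ B ∈ blocks s X, (expNegH H B φ + (expNegH (H + Y + Z) B φ - expNegH (H + Y) B φ))) :=
    contDiff_prod fun B _ => (hEd H B).add ((hEd (H + Y + Z) B).sub (hEd (H + Y) B))
  have hD : ContDiff ℝ r₀ (fun φ => ∏ B ∈ blocks s X, expNegH H B φ) := contDiff_prod fun B _ => hEd H B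
  have hE : ContDiff ℝ r₀ (fun φ => ∏ B ∈ blocks s X, expNegH (H + Z) B φ) := contDiff_prod fun B _ => hEd (H + Z) B
  have h12 := TayNormLE.add h1 h2 (((hA.sub hBB).sub hC).add hD) (hC.sub hE)
  have hfun : ((fun φ => ∏ B ∈ blocks s X, (expNegH H B φ + (expNegH (H + Y) B φ - expNegH H B φ)
          + (expNegH (H + Y + Z) B φ - expNegH (H + Y) B φ))
        - ∏ B ∈ blocks s X, (expNegH H B φ + (expNegH (H + Y) B φ - expNegH H B φ))
        - ∏ B ∈ blocks s X, (expNegH H B φ + (expNegH (H + Y + Z) B φ - expNegH (H + Y) B φ))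
        + ∏ B ∈ blocks s X, expNegH H B φ)
      + fun φ => ∏ B ∈ blocks s X, (expNegH H B φ + (expNegH (H + Y + Z) B φ - expNegH (H + Y) B φ))
        - ∏ B ∈ blocks s X, expNegH (H + Z) B φ)
      = fun φ => expNegH (H + Y + Z) X φ - expNegH (H + Y) X φ - expNegH (H + Z) X φ + expNegH H X φ := by
    funext φ
    simp only [Pi.add_apply]
    have hb : ∀ H₀ : RelevantHamiltonian ℂ d, ∏ B ∈ blocks s X, expNegH H₀ B φ = expNegH H₀ X φ :=
      fun H₀ => bprod_cexp_neg_eval H₀ hX' φ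
    have e1 : ∏ B ∈ blocks s X, (expNegH H B φ + (expNegH (H + Y) B φ - expNegH H B φ)
        + (expNegH (H + Y + Z) B φ - expNegH (H + Y) B φ)) = expNegH (H + Y + Z) X φ := by
      rw [← hb (H + Y + Z)]
      exact Finset.prod_congr rfl fun B _ => by ring
    have e2 : ∏ B ∈ blocks s X, (expNegH H B φ + (expNegH (H + Y) B φ - expNegH H B φ)) = expNegH (H + Y) X φ := by
      rw [← hb (H + Y)]
      exact Finset.prod_congr rfl fun B _ => by ring
    have e3 : ∏ B ∈ blocks s X, expNegH H B φ = expNegH H X φ := hb H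
    have e4 : ∏ B ∈ blocks s X, expNegH (H + Z) B φ = expNegH (H + Z) X φ := hb (H + Z)
    rw [e1, e2, e3, e4]
    ring
  have hWeq : (fun φ : (Fin d → ZMod M) → ℝ => ∏ B ∈ blocks s X, expWeight (G k B) φ) = expWeight (G k X) :=
    funext fun φ => prod_expWeight_blocks hGs k s hX' φ
  rw [hfun, hWeq] at h12
  simp only [Finset.prod_const, card_blocks_eq_numBlocks] at h12
  convert h12 using 2
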